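import Mathlib
import Literature.AlgebraicGeometry.Resolution.RegularLocalOrderValuation
import Literature.AlgebraicGeometry.Resolution.BenitoVillamayor2013Cleaning
import Literature.AlgebraicGeometry.Resolution.SmoothImpliesRegular
import HarnessLib

/-!
# A `p^N`-th-power translate of a regular parameter is a regular parameter

Topic: `Literature/AlgebraicGeometry/Resolution` (sibling of `RegularLocalOrderValuation.lean`, whose `adicOrder` =
`ord_𝔪` is the order used throughout). A brick of positive-characteristic commutative algebra used whenever a local
coordinate `y` at one closed point is RE-CENTRED at another closed point `η` by subtracting a `p^N`-th power `u = v^{p^N}`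
(`N ≥ 1`) so that `y − u` vanishes at `η` (e.g. [Hironaka2017] §10 p.59 l.26–28, items (1)–(2) of the set-up of
Lem. 10.1: «u(i,η) ∈ ρ^N(O(V))», «y(i,η) = y(i) − u(i,η) ∈ max(O_η)» — an UNREFEREED manuscript adjudicated in the
campaign cell `res-hironaka`; NOTHING of it is asserted here, the lemmas below are classical and manuscript-free).

**The point.** In characteristic `p` every derivation kills `p^N`-th powers (`D(a^{p^N}) = p^N a^{p^N−1} Da = 0`,
[Matsumura1987] §25, opening remark), so `d(y − u) = dy`; and the conormal map of the second fundamental exact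
sequence `𝔪/𝔪² → κ ⊗_O Ω[O⁄R]`, `f ↦ df ⊗ 1` ([Matsumura1987] Thm. 25.2) is well defined, i.e. `f ∈ 𝔪² ⇒ 1 ⊗ df = 0`.
Hence: **if `y − u ∈ 𝔪_η` and the differential `dy` does not vanish at `η` — `1 ⊗ dy ≠ 0` in the cotangent fibre
`κ(η) ⊗_{O_η} Ω[O_η⁄R]` — then `ord_η(y − u) = 1`.** No regularity, smoothness, Noetherianity or perfectness of a
base field is needed, and the base ring `R` of the differentials is arbitrary. A differential-free sibling covers the
case where `y` itself already has order `1` at `η` (`u = v^{n} ∈ 𝔪`, `n ≥ 2`, forces `u ∈ 𝔪^{n} ⊆ 𝔪²`). In a REGULAR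
local ring the order is a valuation (`adicOrder_mul`, `adicOrder_pow`), which gives the order-`q` consequences
`ord((y − u)^q) = q` and `ord((y − u)^q + ε) = q` for `ord ε > q` (the shape of an LL-head `x^q + ε` re-centred at `η`).

## Contents (all in namespace `Literature.AlgebraicGeometry.Resolution`)
* `derivation_apply_pow_eq_zero_of_natCast_eq_zero`, `derivation_apply_pow_char_pow` — `D(a^{p^N}) = 0`;
  `derivation_apply_sub_pow_char_pow` — `D(y − v^{p^N}) = D y`.
* (imported from `SmoothImpliesRegular.lean`: `one_tmul_D_eq_zero_of_mem_sq` — `f ∈ 𝔪² ⇒ 1 ⊗ df = 0` in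
  `κ ⊗_O Ω[O⁄R]`, the well-definedness of the conormal map `δ` of [Matsumura1987] Thm. 25.2.)
* `not_mem_sq_maximalIdeal_of_one_tmul_D_ne_zero`, `adicOrder_le_one_of_one_tmul_D_ne_zero`,
  `adicOrder_eq_one_of_mem_of_one_tmul_D_ne_zero` — `1 ⊗ df ≠ 0` in `κ ⊗ Ω[O⁄R]` ⇒ `f ∉ 𝔪²`, `ord f ≤ 1`, and `= 1` if
  `f ∈ 𝔪`.
* `adicOrder_sub_pow_eq_one_of_natCast_eq_zero`, `adicOrder_sub_pow_char_pow_eq_one`,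
  `adicOrder_sub_eq_one_of_exists_pow_eq` — **the translate lemma** `ord(y − v^{p^N}) = 1`.
* `pow_mem_pow_maximalIdeal_of_pow_mem`, `adicOrder_sub_eq_one_of_mem_sq`, `adicOrder_sub_pow_eq_one_of_adicOrder_eq_one`
  — the differential-free sibling.
* `adicOrder_pow_of_adicOrder_eq_one`, `adicOrder_pow_add_eq_of_lt`, `adicOrder_sub_pow_char_pow_pow_add_eq` — regular
  local rings: `ord(x^q) = q`, `ord(x^q + ε) = q`, and the re-centred head.
* `adicOrder_germ_sub_eq_one` — the same at the stalk `O_{Z,η}` of a scheme for sections `y, u ∈ Γ(Z,V)` with `u` a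
  `p^N`-th power of a section and `Γ(Z,V)` of characteristic `p`.
* `one_tmul_D_ne_zero_of_derivation_apply_not_mem`, `adicOrder_sub_pow_char_pow_eq_one_of_derivation`,
  `adicOrder_sub_eq_one_of_exists_pow_eq_of_derivation` — bridge from the DERIVATION form («some `R`-derivation
  `δ : O → O` has `δ y ∉ 𝔪`») to the Kähler form, and the translate lemma in derivation form (appended).

## Sources
* H. Matsumura, *Commutative Ring Theory* (1986), §25: opening remark (`D(aⁿ) = n aⁿ⁻¹ Da`, hence `D(aᵖ) = 0` in
  characteristic `p`) and Thm. 25.2 (second fundamental exact sequence, `δ(x mod 𝔪²) = d x ⊗ 1`). [Matsumura1987]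
* O. Zariski, P. Samuel, *Commutative Algebra* II (1960), Ch. VIII §1 (order function of a local ring; a valuation for
  regular local rings). [ZariskiSamuel1960]
-/

open scoped TensorProduct
open IsLocalRing

namespace Literature.AlgebraicGeometry.Resolution

universe u v w

/-! ## Derivations kill `p^N`-th powers -/

section Derivations

variable {R : Type u} {A : Type v} {M : Type w} [CommRing R] [CommRing A] [Algebra R A]
  [AddCommGroup M] [Module A M] [Module R M]

/-- If `n = 0` in `A` then every derivation of `A` kills `n`-th powers: `D(aⁿ) = n aⁿ⁻¹ Da = 0`.
[cite: Matsumura1987, §25 (opening remark: D(aⁿ) = n aⁿ⁻¹ Da)] -/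
theorem derivation_apply_pow_eq_zero_of_natCast_eq_zero {n : ℕ} (hn : (n : A) = 0) (D : Derivation R A M)
    (a : A) : D (a ^ n) = 0 := by
  rw [Derivation.leibniz_pow, ← Nat.cast_smul_eq_nsmul A, hn, zero_smul]

/-- In characteristic `p`, every derivation kills `p^N`-th powers for `N ≥ 1`: `D(a^{p^N}) = 0`.
[cite: Matsumura1987, §25 (opening remark: D(aᵖ) = 0 in characteristic p)] -/
theorem derivation_apply_pow_char_pow (p : ℕ) [CharP A p] {N : ℕ} (hN : N ≠ 0) (D : Derivation R A M)
    (a : A) : D (a ^ (p ^ N)) = 0 :=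
  derivation_apply_pow_eq_zero_of_natCast_eq_zero
    (by rw [Nat.cast_pow, CharP.cast_eq_zero, zero_pow hN]) D a

/-- Derivations do not see a `p^N`-th-power translate (`N ≥ 1`): `D(y − v^{p^N}) = D y`.
[cite: Matsumura1987, §25 (opening remark: D(aᵖ) = 0 in characteristic p)] -/
theorem derivation_apply_sub_pow_char_pow (p : ℕ) [CharP A p] {N : ℕ} (hN : N ≠ 0) (D : Derivation R A M)
    (y v : A) : D (y - v ^ (p ^ N)) = D y := by
  rw [map_sub, derivation_apply_pow_char_pow p hN D v, sub_zero]

end Derivations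

/-! ## Local rings: a non-vanishing differential detects order `≤ 1` -/

section Local

variable {R : Type u} {O : Type v} [CommRing R] [CommRing O] [IsLocalRing O] [Algebra R O]

/-- If the value of `df` in the cotangent fibre `κ ⊗_O Ω[O⁄R]` (`κ` the residue field) is non-zero, then `f ∉ 𝔪²`.
[cite: Matsumura1987, Thm. 25.2 (second fundamental exact sequence: δ(x mod 𝔪²) = d x ⊗ 1)] -/
theorem not_mem_sq_maximalIdeal_of_one_tmul_D_ne_zero {f : O}
    (h : (1 : ResidueField O) ⊗ₜ[O] (KaehlerDifferential.D R O f) ≠ 0) : f ∉ maximalIdeal O ^ 2 :=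
  fun hf => h (one_tmul_D_eq_zero_of_mem_sq (R := R) hf)

/-- If `1 ⊗ df ≠ 0` in `κ ⊗_O Ω[O⁄R]` then `ord_𝔪(f) ≤ 1`.
[cite: Matsumura1987, Thm. 25.2 (second fundamental exact sequence: δ(x mod 𝔪²) = d x ⊗ 1)] -/
theorem adicOrder_le_one_of_one_tmul_D_ne_zero {f : O}
    (h : (1 : ResidueField O) ⊗ₜ[O] (KaehlerDifferential.D R O f) ≠ 0) : adicOrder f ≤ 1 := by
  rw [← Nat.cast_one, adicOrder_le_iff]
  exact not_mem_sq_maximalIdeal_of_one_tmul_D_ne_zero h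

/-- If `f ∈ 𝔪` and `1 ⊗ df ≠ 0` in `κ ⊗_O Ω[O⁄R]` (the differential of `f` does not vanish at the closed point), then
`ord_𝔪(f) = 1`. [cite: Matsumura1987, Thm. 25.2 (second fundamental exact sequence: δ(x mod 𝔪²) = d x ⊗ 1)] -/
theorem adicOrder_eq_one_of_mem_of_one_tmul_D_ne_zero {f : O} (hf : f ∈ maximalIdeal O)
    (h : (1 : ResidueField O) ⊗ₜ[O] (KaehlerDifferential.D R O f) ≠ 0) : adicOrder f = 1 :=
  le_antisymm (adicOrder_le_one_of_one_tmul_D_ne_zero h)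
    (by rw [← Nat.cast_one, le_adicOrder_iff, pow_one]; exact hf)

/-! ## The translate lemma -/

/-- **A `p^N`-th-power translate of a regular parameter is a regular parameter** (form with the hypothesis
`n = 0` in `O`, e.g. `n = p^N` at a stalk whose ring of sections has characteristic `p`): if `y − vⁿ ∈ 𝔪` and
`1 ⊗ dy ≠ 0` in `κ ⊗_O Ω[O⁄R]`, then `ord_𝔪(y − vⁿ) = 1` — since `d(vⁿ) = n vⁿ⁻¹ dv = 0`, `1 ⊗ d(y − vⁿ) = 1 ⊗ dy ≠ 0`,
so `y − vⁿ ∉ 𝔪²`. [cite: Matsumura1987, §25 opening remark and Thm. 25.2] -/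
theorem adicOrder_sub_pow_eq_one_of_natCast_eq_zero {n : ℕ} (hn : (n : O) = 0) {y : O} (v : O)
    (hmem : y - v ^ n ∈ maximalIdeal O) (hdy : (1 : ResidueField O) ⊗ₜ[O] (KaehlerDifferential.D R O y) ≠ 0) :
    adicOrder (y - v ^ n) = 1 := by
  refine adicOrder_eq_one_of_mem_of_one_tmul_D_ne_zero (R := R) hmem ?_
  rwa [map_sub, derivation_apply_pow_eq_zero_of_natCast_eq_zero hn, sub_zero]

/-- **A `p^N`-th-power translate of a regular parameter is a regular parameter.** In a local ring `(O, 𝔪, κ)` of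
characteristic `p` which is an `R`-algebra: if `N ≥ 1`, `y − v^{p^N} ∈ 𝔪` and the differential of `y` does not vanish
at the closed point (`1 ⊗ dy ≠ 0` in `κ ⊗_O Ω[O⁄R]`), then `ord_𝔪(y − v^{p^N}) = 1`. (The re-centring
«y(i,η) = y(i) − u(i,η) ∈ max(O_η), u(i,η) ∈ ρ^N(O(V))» of a coordinate at another closed point keeps it a regular
parameter there.) [cite: Matsumura1987, §25 opening remark and Thm. 25.2] -/
theorem adicOrder_sub_pow_char_pow_eq_one (p : ℕ) [CharP O p] {N : ℕ} (hN : N ≠ 0) {y : O} (v : O)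
    (hmem : y - v ^ (p ^ N) ∈ maximalIdeal O)
    (hdy : (1 : ResidueField O) ⊗ₜ[O] (KaehlerDifferential.D R O y) ≠ 0) :
    adicOrder (y - v ^ (p ^ N)) = 1 :=
  adicOrder_sub_pow_eq_one_of_natCast_eq_zero (R := R)
    (by rw [Nat.cast_pow, CharP.cast_eq_zero, zero_pow hN]) v hmem hdy

/-- The translate lemma with `u` any `p^N`-th power (`N ≥ 1`), e.g. the germ of a section of `ρ^N(O(V))`
(`ρ` = Frobenius): `y − u ∈ 𝔪`, `1 ⊗ dy ≠ 0` ⇒ `ord_𝔪(y − u) = 1`.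
[cite: Matsumura1987, §25 opening remark and Thm. 25.2] -/
theorem adicOrder_sub_eq_one_of_exists_pow_eq (p : ℕ) [CharP O p] {N : ℕ} (hN : N ≠ 0) {y u : O}
    (hu : ∃ v : O, v ^ (p ^ N) = u) (hmem : y - u ∈ maximalIdeal O)
    (hdy : (1 : ResidueField O) ⊗ₜ[O] (KaehlerDifferential.D R O y) ≠ 0) : adicOrder (y - u) = 1 := by
  obtain ⟨v, rfl⟩ := hu
  exact adicOrder_sub_pow_char_pow_eq_one (R := R) p hN v hmem hdy

/-! ## The differential-free sibling: `ord y = 1` already -/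

omit [Algebra R O] in
/-- An `n`-th power lying in `𝔪` lies in `𝔪ⁿ` (`𝔪` is prime). [cite: ZariskiSamuel1960, Ch. VIII §1] -/
theorem pow_mem_pow_maximalIdeal_of_pow_mem {v : O} {n : ℕ} (h : v ^ n ∈ maximalIdeal O) :
    v ^ n ∈ maximalIdeal O ^ n :=
  Ideal.pow_mem_pow ((maximalIdeal.isMaximal O).isPrime.mem_of_pow_mem n h) n

omit [Algebra R O] in
/-- `ord y = 1` and `u ∈ 𝔪²` ⇒ `ord(y − u) = 1`. [cite: ZariskiSamuel1960, Ch. VIII §1] -/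
theorem adicOrder_sub_eq_one_of_mem_sq {y u : O} (hy : adicOrder y = 1) (hu : u ∈ maximalIdeal O ^ 2) :
    adicOrder (y - u) = 1 := by
  rw [sub_eq_add_neg]
  have h := BV2013.adicOrder_add_eq_of_mem (n := 1) (x := y) (y := -u) (by rw [hy, Nat.cast_one]) (neg_mem hu)
  rw [h, Nat.cast_one]

omit [Algebra R O] in
/-- **Differential-free translate lemma**: if `ord_𝔪(y) = 1`, `n ≥ 2` and `y − vⁿ ∈ 𝔪`, then `ord_𝔪(y − vⁿ) = 1`
(`vⁿ ∈ 𝔪` forces `v ∈ 𝔪`, so `vⁿ ∈ 𝔪ⁿ ⊆ 𝔪²`). For `n = p^N`, `N ≥ 1`: re-centring a parameter that already vanishes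
to order `1` at `η` by an element of `ρ^N(O(V))` keeps order `1`. [cite: ZariskiSamuel1960, Ch. VIII §1] -/
theorem adicOrder_sub_pow_eq_one_of_adicOrder_eq_one {y v : O} {n : ℕ} (hn : 2 ≤ n) (hy : adicOrder y = 1)
    (hmem : y - v ^ n ∈ maximalIdeal O) : adicOrder (y - v ^ n) = 1 := by
  have hy1 : y ∈ maximalIdeal O := by
    have h := (le_adicOrder_iff y 1).mp (by rw [hy, Nat.cast_one])
    rwa [pow_one] at h
  have hvn : v ^ n ∈ maximalIdeal O := by
    have h := sub_mem hy1 hmem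
    rwa [sub_sub_cancel] at h
  exact adicOrder_sub_eq_one_of_mem_sq hy
    (Ideal.pow_le_pow_right hn (pow_mem_pow_maximalIdeal_of_pow_mem hvn))

end Local

/-! ## Regular local rings: orders of powers and of re-centred heads -/

section Regular

variable {R : Type u} {S : Type v} [CommRing R] [CommRing S] [IsRegularLocalRing S] [Algebra R S]

omit [Algebra R S] in
/-- In a regular local ring, `ord x = 1 ⇒ ord(x^q) = q`. [cite: ZariskiSamuel1960, Ch. VIII §1 Thm. 1] -/
theorem adicOrder_pow_of_adicOrder_eq_one {x : S} (hx : adicOrder x = 1) (q : ℕ) :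
    adicOrder (x ^ q) = (q : ℕ∞) := by
  rw [adicOrder_pow, hx, mul_one]

omit [Algebra R S] in
/-- In a regular local ring, `ord x = 1` and `ord ε > q` ⇒ `ord(x^q + ε) = q` (the order of an LL-head-shaped element
`x^q + ε`). [cite: ZariskiSamuel1960, Ch. VIII §1 Thm. 1] -/
theorem adicOrder_pow_add_eq_of_lt {x ε : S} (hx : adicOrder x = 1) {q : ℕ} (hε : (q : ℕ∞) < adicOrder ε) :
    adicOrder (x ^ q + ε) = (q : ℕ∞) := by
  have hε' : ε ∈ maximalIdeal S ^ (q + 1) :=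
    (le_adicOrder_iff ε (q + 1)).mp (by rw [Nat.cast_add, Nat.cast_one]; exact Order.add_one_le_of_lt hε)
  exact BV2013.adicOrder_add_eq_of_mem (adicOrder_pow_of_adicOrder_eq_one hx q) hε'

/-- **The re-centred head keeps its order.** In a regular local ring `(S, 𝔪, κ)` of characteristic `p` which is an
`R`-algebra: if `N ≥ 1`, `y − v^{p^N} ∈ 𝔪`, `1 ⊗ dy ≠ 0` in `κ ⊗_S Ω[S⁄R]` and `ord ε > q`, then
`ord(y − v^{p^N}) = 1` and `ord((y − v^{p^N})^q + ε) = q`.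
[cite: Matsumura1987, §25 opening remark and Thm. 25.2] [cite: ZariskiSamuel1960, Ch. VIII §1 Thm. 1] -/
theorem adicOrder_sub_pow_char_pow_pow_add_eq (p : ℕ) [CharP S p] {N : ℕ} (hN : N ≠ 0) {y : S} (v : S)
    (hmem : y - v ^ (p ^ N) ∈ maximalIdeal S)
    (hdy : (1 : ResidueField S) ⊗ₜ[S] (KaehlerDifferential.D R S y) ≠ 0) {q : ℕ} {ε : S}
    (hε : (q : ℕ∞) < adicOrder ε) :
    adicOrder (y - v ^ (p ^ N)) = 1 ∧ adicOrder ((y - v ^ (p ^ N)) ^ q + ε) = (q : ℕ∞) :=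
  have h1 := adicOrder_sub_pow_char_pow_eq_one (R := R) p hN v hmem hdy
  ⟨h1, adicOrder_pow_add_eq_of_lt h1 hε⟩

end Regular

/-! ## At the stalk of a scheme -/

section Scheme

open _root_.AlgebraicGeometry

/-- **The translate lemma at a stalk.** Let `Z` be a scheme, `V ⊆ Z` open with `Γ(Z,V)` of characteristic `p`,
`η ∈ V`, and `y, u ∈ Γ(Z,V)` with `u = w^{p^N}` a `p^N`-th power of a section (`N ≥ 1`; membership in
`ρ^N(O(V)) = range (Frob^N)`). If the germ `(y − u)_η` lies in `max(O_{Z,η})` and the differential of `y` does not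
vanish at `η` — `1 ⊗ d(y_η) ≠ 0` in `κ(η) ⊗ Ω[O_{Z,η}⁄R]` for some base ring `R` over which the stalk is an algebra —
then `ord_η(y − u) = 1`. [cite: Matsumura1987, §25 opening remark and Thm. 25.2] -/
theorem adicOrder_germ_sub_eq_one {Z : Scheme.{u}} {V : Z.Opens} (p : ℕ) [CharP Γ(Z, V) p] {N : ℕ}
    (hN : N ≠ 0) {η : Z} (hη : η ∈ V) (R : Type w) [CommRing R] [Algebra R (Z.presheaf.stalk η)]
    (y u : Γ(Z, V)) (hu : ∃ w : Γ(Z, V), w ^ (p ^ N) = u)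
    (hmem : (Z.presheaf.germ V η hη).hom (y - u) ∈ maximalIdeal (Z.presheaf.stalk η))
    (hdy : (1 : ResidueField (Z.presheaf.stalk η)) ⊗ₜ[Z.presheaf.stalk η]
      (KaehlerDifferential.D R (Z.presheaf.stalk η) ((Z.presheaf.germ V η hη).hom y)) ≠ 0) :
    adicOrder ((Z.presheaf.germ V η hη).hom (y - u)) = 1 := by
  obtain ⟨w, rfl⟩ := hu
  have hp : ((p ^ N : ℕ) : Z.presheaf.stalk η) = 0 := by
    rw [← map_natCast (Z.presheaf.germ V η hη).hom, Nat.cast_pow, CharP.cast_eq_zero, zero_pow hN, map_zero]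
  rw [map_sub, map_pow] at hmem ⊢
  exact adicOrder_sub_pow_eq_one_of_natCast_eq_zero (R := R) hp _ hmem hdy

end Scheme

/-! ## Bridge: the derivation form implies the Kähler form (appended 2026-08-26)

If SOME `R`-derivation `δ : O → O` takes a value outside `𝔪` at `y` (e.g. `∂/∂y` for a coordinate system containing
`y`), then `1 ⊗ dy ≠ 0` in `κ ⊗_O Ω[O⁄R]`: `δ` factors through `d` (universal property), giving the `κ`-linear functional
`κ ⊗ Ω[O⁄R] → κ ⊗ O ≅ κ`, `1 ⊗ dy ↦ δ(y) mod 𝔪 ≠ 0`. So every statement above with the hypothesis `1 ⊗ dy ≠ 0` holds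
under the hypothesis «`δ y ∉ 𝔪` for some derivation `δ`». -/

section Bridge

variable {R : Type u} {O : Type v} [CommRing R] [CommRing O] [IsLocalRing O] [Algebra R O]

/-- **Derivation form ⇒ Kähler form.** If an `R`-derivation `δ : O → O` of a local ring has `δ y ∉ 𝔪`, then the
differential of `y` does not vanish at the closed point: `1 ⊗ dy ≠ 0` in `κ ⊗_O Ω[O⁄R]` (universal property of
`Ω[O⁄R]`: `δ = φ ∘ d`, and `κ ⊗ φ` followed by `κ ⊗_O O ≅ κ` sends `1 ⊗ dy` to `δ(y) mod 𝔪`).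
[cite: Matsumura1987, §25 (universal property of Ω_{A/k}: Der_k(A, M) ≅ Hom_A(Ω_{A/k}, M))] -/
theorem one_tmul_D_ne_zero_of_derivation_apply_not_mem (δ : Derivation R O O) {y : O}
    (h : δ y ∉ maximalIdeal O) : (1 : ResidueField O) ⊗ₜ[O] (KaehlerDifferential.D R O y) ≠ 0 := by
  intro h0
  apply h
  have h1 := congrArg (fun t => TensorProduct.rid O (ResidueField O)
    (LinearMap.lTensor (ResidueField O) δ.liftKaehlerDifferential t)) h0
  simp only [LinearMap.lTensor_tmul, Derivation.liftKaehlerDifferential_comp_D, map_zero,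
    TensorProduct.rid_tmul] at h1
  rwa [Algebra.smul_def, mul_one, ResidueField.algebraMap_eq, residue_eq_zero_iff] at h1

/-- **The translate lemma, derivation form.** In a local ring `(O, 𝔪)` of characteristic `p` which is an
`R`-algebra: if some `R`-derivation `δ : O → O` has `δ y ∉ 𝔪`, `N ≥ 1` and `y − v^{p^N} ∈ 𝔪`, then
`ord_𝔪(y − v^{p^N}) = 1`. [cite: Matsumura1987, §25 opening remark and Thm. 25.2] -/
theorem adicOrder_sub_pow_char_pow_eq_one_of_derivation (p : ℕ) [CharP O p] {N : ℕ} (hN : N ≠ 0)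
    (δ : Derivation R O O) {y : O} (hδ : δ y ∉ maximalIdeal O) (v : O)
    (hmem : y - v ^ (p ^ N) ∈ maximalIdeal O) : adicOrder (y - v ^ (p ^ N)) = 1 :=
  adicOrder_sub_pow_char_pow_eq_one (R := R) p hN v hmem
    (one_tmul_D_ne_zero_of_derivation_apply_not_mem δ hδ)

/-- Derivation form with `u` any `p^N`-th power (`N ≥ 1`): `δ y ∉ 𝔪`, `y − u ∈ 𝔪` ⇒ `ord_𝔪(y − u) = 1`.
[cite: Matsumura1987, §25 opening remark and Thm. 25.2] -/
theorem adicOrder_sub_eq_one_of_exists_pow_eq_of_derivation (p : ℕ) [CharP O p] {N : ℕ} (hN : N ≠ 0)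
    (δ : Derivation R O O) {y u : O} (hδ : δ y ∉ maximalIdeal O) (hu : ∃ v : O, v ^ (p ^ N) = u)
    (hmem : y - u ∈ maximalIdeal O) : adicOrder (y - u) = 1 :=
  adicOrder_sub_eq_one_of_exists_pow_eq (R := R) p hN hu hmem
    (one_tmul_D_ne_zero_of_derivation_apply_not_mem δ hδ)

end Bridge

end Literature.AlgebraicGeometry.Resolution
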